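import Summits.Ventures.YMGap.FlowData.LinkCharacterMerging

/-!
# Venture YMGap, track Y3 FLOW-DATA — the SU(2) slice's character projections have FINITE-DIMENSIONAL RANGE:
# `range P_ν ⊆ span` of finitely many continuous functions, with NO representation theory (theorems only)

HONEST FRAMING: venture file of the cell `pub-ymgap` (QuantumFields programme), track Y3, lineage A (seat flow-eng-1).
Finite Haar integrals over `SU(2)^ι` (one time slice, any finite link set `ι`); no number, no row, nothing about
limits, the continuum or a mass gap.  NO Peter–Weyl, NO Clebsch–Gordan, no irreducible representation is constructed.

WHY.  The end-to-end operator-level kept-set tail theorem for the typed tube (`KWeightTailTubeMain`, flow-eng-1 g13)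
keeps ONE representation-theoretic hypothesis, SPANNING (`hspan : ∀ ν ∈ K, ∀ y, P_ν y ∈ span f` for the kept family
`f`).  Its discharge (`KWeightTailTubeSpan`) produces the kept family by the finite-dimensional spectral theorem on the
`𝒦`-invariant subspace `⊕_{ν ∈ K} range P_ν`; the input proved HERE is that each `range P_ν` is finite-dimensional.
The proof is elementary: the dressed character kernel `d_ν X_ν(a,b) = d_ν Π_e U_{ν_e}(a₀(b_e a_e⁻¹))` is SEPARATED —
a finite sum `Σ_i A_i(a) B_i(b)` of products of continuous functions — because `a₀(b a⁻¹) = a₀(a)a₀(b) + Σ_k x_k(a)x_k(b)`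
is the Euclidean inner product of `ℝ⁴ ⊃ S³ ≅ SU(2)` (`su2a0_inv_mul`) and `U_ν` is a polynomial; hence
`(P_ν φ)(a) = Σ_i (∫ B_i φ) A_i(a)` lies in the span of the finitely many `A_i`.

* `separated_*` — the closure calculus of separated kernels `K(x,y) = Σ_{i ∈ κ} A_i(x) B_i(y)` (`κ` a `Fintype`,
  `A_i`, `B_i` continuous): constants, rank one, sums, products, scalars, powers, polynomials, pull-backs, finite
  products over links (stated with the existential spelled out; no definition is introduced);
* `separated_su2a0`, `separated_su2Character`, `separated_prod_su2Character`, `separated_charProjKernel` — the SU(2)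
  instances up to `d_ν X_ν`;
* `coeFn_sum_smul_toLp` — the a.e. representative of a finite linear combination of `L²` classes of continuous functions;
* **`charProjOp_mem_span_finite`** — for any operator `P_ν` acting a.e. by `d_ν ∫ X_ν(·,b) φ(b) db`
  (`KWeightTailTubeCharProj.exists_charProjOp`) there are finitely many `w_i ∈ L²` with `P_ν φ ∈ span {w_i}` for
  EVERY `φ`; **`finiteDimensional_range_charProjOp`** — `range P_ν` is finite-dimensional.

References: I. Montvay, G. Münster (1994) §3.4.2 [cite: MontvayMunster1994, §3.4.2] (character expansion on the links);
the separation argument is folklore (finite-rank integral operators).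
-/

noncomputable section

open scoped BigOperators ENNReal
open MeasureTheory Filter Function Polynomial Polynomial.Chebyshev
open Literature.MathematicalPhysics.QuantumFieldTheory
open Summit.Ventures.LatticeQCDFlow.Exactness Summit.Ventures.LatticeQCDFlow.Scoring

namespace Summit.Ventures.YMGap.FlowData

namespace KWeightTailOperator

/-! ### §1 Separated kernels: the closure calculus -/

section Separated

variable {X Y : Type*} [TopologicalSpace X] [TopologicalSpace Y]

/-- Transport of a separated expansion along a pointwise identity of kernels. [folklore] -/
theorem separated_congr {K K' : X → Y → ℝ} (h : ∀ x y, K x y = K' x y)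
    (hK' : ∃ (κ : Type) (_ : Fintype κ) (A : κ → X → ℝ) (B : κ → Y → ℝ),
      (∀ i, Continuous (A i)) ∧ (∀ i, Continuous (B i)) ∧ ∀ x y, K' x y = ∑ i, A i x * B i y) :
    ∃ (κ : Type) (_ : Fintype κ) (A : κ → X → ℝ) (B : κ → Y → ℝ),
      (∀ i, Continuous (A i)) ∧ (∀ i, Continuous (B i)) ∧ ∀ x y, K x y = ∑ i, A i x * B i y := by
  obtain ⟨κ, hκ, A, B, hA, hB, hK⟩ := hK'
  exact ⟨κ, hκ, A, B, hA, hB, fun x y => (h x y).trans (hK x y)⟩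

/-- A constant kernel is separated (one term). [folklore] -/
theorem separated_const (c : ℝ) :
    ∃ (κ : Type) (_ : Fintype κ) (A : κ → X → ℝ) (B : κ → Y → ℝ),
      (∀ i, Continuous (A i)) ∧ (∀ i, Continuous (B i)) ∧ ∀ x y, (fun (_ : X) (_ : Y) => c) x y = ∑ i, A i x * B i y :=
  ⟨Unit, inferInstance, fun _ _ => c, fun _ _ => 1, fun _ => continuous_const, fun _ => continuous_const,
    fun x y => by simp⟩

/-- A rank-one kernel `f(x) g(y)` with continuous factors is separated. [folklore] -/
theorem separated_single {f : X → ℝ} {g : Y → ℝ} (hf : Continuous f) (hg : Continuous g) :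
    ∃ (κ : Type) (_ : Fintype κ) (A : κ → X → ℝ) (B : κ → Y → ℝ),
      (∀ i, Continuous (A i)) ∧ (∀ i, Continuous (B i)) ∧ ∀ x y, (fun x y => f x * g y) x y = ∑ i, A i x * B i y :=
  ⟨Unit, inferInstance, fun _ => f, fun _ => g, fun _ => hf, fun _ => hg, fun x y => by simp⟩

/-- Sums of separated kernels are separated (index `κ ⊕ κ'`). [folklore] -/
theorem separated_add {K K' : X → Y → ℝ}
    (hK : ∃ (κ : Type) (_ : Fintype κ) (A : κ → X → ℝ) (B : κ → Y → ℝ),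
      (∀ i, Continuous (A i)) ∧ (∀ i, Continuous (B i)) ∧ ∀ x y, K x y = ∑ i, A i x * B i y)
    (hK' : ∃ (κ : Type) (_ : Fintype κ) (A : κ → X → ℝ) (B : κ → Y → ℝ),
      (∀ i, Continuous (A i)) ∧ (∀ i, Continuous (B i)) ∧ ∀ x y, K' x y = ∑ i, A i x * B i y) :
    ∃ (κ : Type) (_ : Fintype κ) (A : κ → X → ℝ) (B : κ → Y → ℝ),
      (∀ i, Continuous (A i)) ∧ (∀ i, Continuous (B i)) ∧ ∀ x y, (fun x y => K x y + K' x y) x y = ∑ i, A i x * B i y := by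
  obtain ⟨κ, hκ, A, B, hA, hB, h⟩ := hK
  obtain ⟨κ', hκ', A', B', hA', hB', h'⟩ := hK'
  refine ⟨κ ⊕ κ', inferInstance, Sum.elim A A', Sum.elim B B', ?_, ?_, fun x y => ?_⟩
  · rintro (i | i)
    · exact hA i
    · exact hA' i
  · rintro (i | i)
    · exact hB i
    · exact hB' i
  · simp only [Fintype.sum_sum_type, Sum.elim_inl, Sum.elim_inr]
    rw [h, h']

/-- Products of separated kernels are separated (index `κ × κ'`). [folklore] -/
theorem separated_mul {K K' : X → Y → ℝ}
    (hK : ∃ (κ : Type) (_ : Fintype κ) (A : κ → X → ℝ) (B : κ → Y → ℝ),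
      (∀ i, Continuous (A i)) ∧ (∀ i, Continuous (B i)) ∧ ∀ x y, K x y = ∑ i, A i x * B i y)
    (hK' : ∃ (κ : Type) (_ : Fintype κ) (A : κ → X → ℝ) (B : κ → Y → ℝ),
      (∀ i, Continuous (A i)) ∧ (∀ i, Continuous (B i)) ∧ ∀ x y, K' x y = ∑ i, A i x * B i y) :
    ∃ (κ : Type) (_ : Fintype κ) (A : κ → X → ℝ) (B : κ → Y → ℝ),
      (∀ i, Continuous (A i)) ∧ (∀ i, Continuous (B i)) ∧ ∀ x y, (fun x y => K x y * K' x y) x y = ∑ i, A i x * B i y := by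
  obtain ⟨κ, hκ, A, B, hA, hB, h⟩ := hK
  obtain ⟨κ', hκ', A', B', hA', hB', h'⟩ := hK'
  refine ⟨κ × κ', inferInstance, fun p x => A p.1 x * A' p.2 x, fun p y => B p.1 y * B' p.2 y,
    fun p => (hA p.1).mul (hA' p.2), fun p => (hB p.1).mul (hB' p.2), fun x y => ?_⟩
  simp only
  rw [h, h', Finset.sum_mul_sum, Fintype.sum_prod_type]
  refine Finset.sum_congr rfl fun i _ => Finset.sum_congr rfl fun j _ => ?_
  ring

/-- Scalar multiples of separated kernels are separated. [folklore] -/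
theorem separated_smul (c : ℝ) {K : X → Y → ℝ}
    (hK : ∃ (κ : Type) (_ : Fintype κ) (A : κ → X → ℝ) (B : κ → Y → ℝ),
      (∀ i, Continuous (A i)) ∧ (∀ i, Continuous (B i)) ∧ ∀ x y, K x y = ∑ i, A i x * B i y) :
    ∃ (κ : Type) (_ : Fintype κ) (A : κ → X → ℝ) (B : κ → Y → ℝ),
      (∀ i, Continuous (A i)) ∧ (∀ i, Continuous (B i)) ∧ ∀ x y, (fun x y => c * K x y) x y = ∑ i, A i x * B i y :=
  separated_mul (separated_const c) hK

/-- Powers of a separated kernel are separated. [folklore] -/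
theorem separated_pow {K : X → Y → ℝ}
    (hK : ∃ (κ : Type) (_ : Fintype κ) (A : κ → X → ℝ) (B : κ → Y → ℝ),
      (∀ i, Continuous (A i)) ∧ (∀ i, Continuous (B i)) ∧ ∀ x y, K x y = ∑ i, A i x * B i y) (n : ℕ) :
    ∃ (κ : Type) (_ : Fintype κ) (A : κ → X → ℝ) (B : κ → Y → ℝ),
      (∀ i, Continuous (A i)) ∧ (∀ i, Continuous (B i)) ∧ ∀ x y, (fun x y => K x y ^ n) x y = ∑ i, A i x * B i y := by
  induction n with
  | zero => exact separated_congr (fun x y => by simp) (separated_const 1)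
  | succ n ih => exact separated_congr (fun x y => by simp only [pow_succ]) (separated_mul ih hK)

/-- A polynomial in a separated kernel is separated. [folklore] -/
theorem separated_polynomial (p : ℝ[X]) {K : X → Y → ℝ}
    (hK : ∃ (κ : Type) (_ : Fintype κ) (A : κ → X → ℝ) (B : κ → Y → ℝ),
      (∀ i, Continuous (A i)) ∧ (∀ i, Continuous (B i)) ∧ ∀ x y, K x y = ∑ i, A i x * B i y) :
    ∃ (κ : Type) (_ : Fintype κ) (A : κ → X → ℝ) (B : κ → Y → ℝ),
      (∀ i, Continuous (A i)) ∧ (∀ i, Continuous (B i)) ∧ ∀ x y, (fun x y => p.eval (K x y)) x y = ∑ i, A i x * B i y := by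
  induction p using Polynomial.induction_on' with
  | add p q hp hq => exact separated_congr (fun x y => by simp only [eval_add]) (separated_add hp hq)
  | monomial n a =>
    exact separated_congr (fun x y => by simp only [eval_monomial]) (separated_smul a (separated_pow hK n))

/-- Pull-back of a separated kernel along continuous maps is separated. [folklore] -/
theorem separated_comp {X' Y' : Type*} [TopologicalSpace X'] [TopologicalSpace Y'] {u : X' → X} {v : Y' → Y}
    (hu : Continuous u) (hv : Continuous v) {K : X → Y → ℝ}
    (hK : ∃ (κ : Type) (_ : Fintype κ) (A : κ → X → ℝ) (B : κ → Y → ℝ),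
      (∀ i, Continuous (A i)) ∧ (∀ i, Continuous (B i)) ∧ ∀ x y, K x y = ∑ i, A i x * B i y) :
    ∃ (κ : Type) (_ : Fintype κ) (A : κ → X' → ℝ) (B : κ → Y' → ℝ),
      (∀ i, Continuous (A i)) ∧ (∀ i, Continuous (B i)) ∧ ∀ x y, (fun x y => K (u x) (v y)) x y = ∑ i, A i x * B i y := by
  obtain ⟨κ, hκ, A, B, hA, hB, h⟩ := hK
  exact ⟨κ, hκ, fun i x => A i (u x), fun i y => B i (v y), fun i => (hA i).comp hu, fun i => (hB i).comp hv,
    fun x y => h (u x) (v y)⟩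

/-- Finite products of separated kernels are separated. [folklore] -/
theorem separated_finset_prod {ι : Type*} {K : ι → X → Y → ℝ}
    (hK : ∀ e, ∃ (κ : Type) (_ : Fintype κ) (A : κ → X → ℝ) (B : κ → Y → ℝ),
      (∀ i, Continuous (A i)) ∧ (∀ i, Continuous (B i)) ∧ ∀ x y, K e x y = ∑ i, A i x * B i y) (s : Finset ι) :
    ∃ (κ : Type) (_ : Fintype κ) (A : κ → X → ℝ) (B : κ → Y → ℝ),
      (∀ i, Continuous (A i)) ∧ (∀ i, Continuous (B i)) ∧ ∀ x y, (fun x y => ∏ e ∈ s, K e x y) x y = ∑ i, A i x * B i y := by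
  classical
  induction s using Finset.induction_on with
  | empty => exact separated_congr (fun x y => by simp) (separated_const 1)
  | insert e s he ih =>
    exact separated_congr (fun x y => by simp only [Finset.prod_insert he]) (separated_mul (hK e) ih)

end Separated

/-! ### §2 The SU(2) character kernels are separated -/

section SUTwo

/-- `a₀(b a⁻¹) = a₀(a) a₀(b) + Σ_k x_k(a) x_k(b)` — the SU(2) link kernel argument is a separated kernel (the Euclidean
inner product of `ℝ⁴`; `su2a0_inv_mul`). [folklore] -/
theorem separated_su2a0 :
    ∃ (κ : Type) (_ : Fintype κ) (A B : κ → Matrix.specialUnitaryGroup (Fin 2) ℂ → ℝ),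
      (∀ i, Continuous (A i)) ∧ (∀ i, Continuous (B i)) ∧
        ∀ a b, (fun a b : Matrix.specialUnitaryGroup (Fin 2) ℂ => su2a0 (b * a⁻¹)) a b = ∑ i, A i a * B i b := by
  have mx : ∀ Z : Matrix (Fin 2) (Fin 2) ℂ, Continuous (su2x Z) := fun Z => by
    unfold su2x
    exact ((Complex.continuous_re.comp ((continuous_const.matrix_mul
      continuous_subtype_val).matrix_trace)).neg).div_const _
  refine separated_congr (K' := fun a b => su2a0 a * su2a0 b +
      (su2x genZ1 a * su2x genZ1 b + su2x genZ2 a * su2x genZ2 b + su2x genZ3 a * su2x genZ3 b)) (fun a b => ?_) ?_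
  · show su2a0 (b * a⁻¹) = _
    rw [su2a0_mul_comm b a⁻¹, su2a0_inv_mul a b]
  · exact separated_add (separated_single continuous_su2a0 continuous_su2a0)
      (separated_add (separated_add (separated_single (mx genZ1) (mx genZ1)) (separated_single (mx genZ2) (mx genZ2)))
        (separated_single (mx genZ3) (mx genZ3)))

/-- The link character kernel `χ_ν(b a⁻¹) = U_ν(a₀(b a⁻¹))` is separated. [folklore] -/
theorem separated_su2Character (ν : ℕ) :
    ∃ (κ : Type) (_ : Fintype κ) (A B : κ → Matrix.specialUnitaryGroup (Fin 2) ℂ → ℝ),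
      (∀ i, Continuous (A i)) ∧ (∀ i, Continuous (B i)) ∧
        ∀ a b, (fun a b : Matrix.specialUnitaryGroup (Fin 2) ℂ => (U ℝ ν).eval (su2a0 (b * a⁻¹))) a b =
          ∑ i, A i a * B i b :=
  separated_polynomial (U ℝ ν) separated_su2a0

variable {ι : Type} [Fintype ι]

/-- The multi-link character kernel `X_ν(a,b) = Π_e χ_{ν_e}(b_e a_e⁻¹)` is separated. [folklore] -/
theorem separated_prod_su2Character (ν : ι → ℕ) :
    ∃ (κ : Type) (_ : Fintype κ) (A B : κ → (ι → Matrix.specialUnitaryGroup (Fin 2) ℂ) → ℝ),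
      (∀ i, Continuous (A i)) ∧ (∀ i, Continuous (B i)) ∧
        ∀ a b, (fun a b : ι → Matrix.specialUnitaryGroup (Fin 2) ℂ => ∏ e, (U ℝ (ν e)).eval (su2a0 (b e * (a e)⁻¹))) a b =
          ∑ i, A i a * B i b := by
  have hproj : ∀ e : ι, Continuous fun a : ι → Matrix.specialUnitaryGroup (Fin 2) ℂ => a e :=
    fun e => continuous_apply e
  have hlink : ∀ e : ι, ∃ (κ : Type) (_ : Fintype κ) (A B : κ → (ι → Matrix.specialUnitaryGroup (Fin 2) ℂ) → ℝ),
      (∀ i, Continuous (A i)) ∧ (∀ i, Continuous (B i)) ∧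
        ∀ a b, (fun a b : ι → Matrix.specialUnitaryGroup (Fin 2) ℂ => (U ℝ (ν e)).eval (su2a0 (b e * (a e)⁻¹))) a b =
          ∑ i, A i a * B i b := fun e =>
    separated_comp (u := fun a : ι → Matrix.specialUnitaryGroup (Fin 2) ℂ => a e)
      (v := fun b : ι → Matrix.specialUnitaryGroup (Fin 2) ℂ => b e) (hproj e) (hproj e)
      (K := fun a b : Matrix.specialUnitaryGroup (Fin 2) ℂ => (U ℝ (ν e)).eval (su2a0 (b * a⁻¹)))
      (separated_su2Character (ν e))
  exact separated_finset_prod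
    (K := fun e (a b : ι → Matrix.specialUnitaryGroup (Fin 2) ℂ) => (U ℝ (ν e)).eval (su2a0 (b e * (a e)⁻¹)))
    hlink Finset.univ

/-- The dressed character kernel `d_ν X_ν(a,b)` of the projection `P_ν` is separated. [folklore] -/
theorem separated_charProjKernel (ν : ι → ℕ) :
    ∃ (κ : Type) (_ : Fintype κ) (A B : κ → (ι → Matrix.specialUnitaryGroup (Fin 2) ℂ) → ℝ),
      (∀ i, Continuous (A i)) ∧ (∀ i, Continuous (B i)) ∧
        ∀ a b, (fun a b : ι → Matrix.specialUnitaryGroup (Fin 2) ℂ =>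
            (∏ e, ((ν e : ℝ) + 1)) * ∏ e, (U ℝ (ν e)).eval (su2a0 (b e * (a e)⁻¹))) a b = ∑ i, A i a * B i b :=
  separated_smul _ (separated_prod_su2Character ν)

end SUTwo

/-! ### §3 `range P_ν` is finite-dimensional -/

section Range

variable {ι : Type} [Fintype ι]

/-- The a.e. representative of a finite linear combination `Σ_{i ∈ s} c_i • [A_i]` of `L²` classes of continuous
functions is `a ↦ Σ_{i ∈ s} c_i A_i(a)`. [folklore] -/
theorem coeFn_sum_smul_toLp {κ : Type} (s : Finset κ) (c : κ → ℝ)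
    {A : κ → (ι → Matrix.specialUnitaryGroup (Fin 2) ℂ) → ℝ} (hA : ∀ i, Continuous (A i)) :
    ((∑ i ∈ s, c i • (SU2Links.memLp_two_of_continuous (hA i)).toLp (A i) :
        Lp ℝ 2 (Measure.pi fun _ : ι => haarProbability (Matrix.specialUnitaryGroup (Fin 2) ℂ))) :
        (ι → Matrix.specialUnitaryGroup (Fin 2) ℂ) → ℝ)
      =ᵐ[Measure.pi fun _ : ι => haarProbability (Matrix.specialUnitaryGroup (Fin 2) ℂ)]
      fun a => ∑ i ∈ s, c i * A i a := by
  classical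
  induction s using Finset.induction_on with
  | empty =>
    simp only [Finset.sum_empty]
    exact Lp.coeFn_zero _ _ _
  | insert j s hj ih =>
    rw [Finset.sum_insert hj]
    filter_upwards [ih, Lp.coeFn_add (c j • (SU2Links.memLp_two_of_continuous (hA j)).toLp (A j))
      (∑ i ∈ s, c i • (SU2Links.memLp_two_of_continuous (hA i)).toLp (A i)),
      Lp.coeFn_smul (c j) ((SU2Links.memLp_two_of_continuous (hA j)).toLp (A j)),
      (SU2Links.memLp_two_of_continuous (hA j)).coeFn_toLp] with a ha hadd hsm hto
    rw [hadd, Pi.add_apply, hsm, Pi.smul_apply, hto, ha, Finset.sum_insert hj, smul_eq_mul]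

/-- **`P_ν φ` lies in the span of FINITELY MANY fixed `L²` vectors, for every `φ`.**  For any operator acting a.e. by the
reproducing integral `(P_ν φ)(a) = d_ν ∫ X_ν(a,b) φ(b) db` (`KWeightTailTubeCharProj.exists_charProjOp`): there are a
finite index type `κ` and `w : κ → L²` with `P_ν φ ∈ span (range w)` for all `φ` (`w_i = [A_i]` for a separated
expansion `d_ν X_ν(a,b) = Σ_i A_i(a) B_i(b)`, coefficients `∫ B_i φ`). [cite: MontvayMunster1994, §3.4.2] -/
theorem charProjOp_mem_span_finite (ν : ι → ℕ)
    {P : Lp ℝ 2 (Measure.pi fun _ : ι => haarProbability (Matrix.specialUnitaryGroup (Fin 2) ℂ)) →L[ℝ]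
        Lp ℝ 2 (Measure.pi fun _ : ι => haarProbability (Matrix.specialUnitaryGroup (Fin 2) ℂ))}
    (hP : ∀ φ, (P φ : (ι → Matrix.specialUnitaryGroup (Fin 2) ℂ) → ℝ)
        =ᵐ[Measure.pi fun _ : ι => haarProbability (Matrix.specialUnitaryGroup (Fin 2) ℂ)]
        fun a => (∏ e, ((ν e : ℝ) + 1)) * ∫ b, (∏ e, (U ℝ (ν e)).eval (su2a0 (b e * (a e)⁻¹))) * φ b
          ∂(Measure.pi fun _ : ι => haarProbability (Matrix.specialUnitaryGroup (Fin 2) ℂ))) :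
    ∃ (κ : Type) (_ : Fintype κ)
      (w : κ → Lp ℝ 2 (Measure.pi fun _ : ι => haarProbability (Matrix.specialUnitaryGroup (Fin 2) ℂ))),
      ∀ φ, P φ ∈ Submodule.span ℝ (Set.range w) := by
  obtain ⟨κ, hκ, A, B, hA, hB, hK⟩ := separated_charProjKernel (ι := ι) ν
  beta_reduce at hK
  refine ⟨κ, hκ, fun i => (SU2Links.memLp_two_of_continuous (hA i)).toLp (A i), fun φ => ?_⟩
  have hφ : Integrable (φ : (ι → Matrix.specialUnitaryGroup (Fin 2) ℂ) → ℝ)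
      (Measure.pi fun _ : ι => haarProbability (Matrix.specialUnitaryGroup (Fin 2) ℂ)) :=
    (Lp.memLp φ).integrable one_le_two
  -- the continuous factors `B_i` are bounded on the compact slice, so `B_i φ` is integrable
  have hBi : ∀ i, Integrable (fun b => B i b * φ b)
      (Measure.pi fun _ : ι => haarProbability (Matrix.specialUnitaryGroup (Fin 2) ℂ)) := fun i => by
    obtain ⟨C, hC⟩ := isCompact_univ.exists_bound_of_continuousOn (hB i).continuousOn
    exact hφ.bdd_mul (hB i).aestronglyMeasurable (Eventually.of_forall fun b => hC b (Set.mem_univ _))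
  -- `P φ = Σ_i (∫ B_i φ) • [A_i]`
  have hPφ : P φ = ∑ i, (∫ b, B i b * φ b ∂(Measure.pi fun _ : ι =>
      haarProbability (Matrix.specialUnitaryGroup (Fin 2) ℂ))) • (SU2Links.memLp_two_of_continuous (hA i)).toLp (A i) := by
    refine Lp.ext ?_
    filter_upwards [hP φ, coeFn_sum_smul_toLp (ι := ι) Finset.univ (fun i => ∫ b, B i b * φ b
      ∂(Measure.pi fun _ : ι => haarProbability (Matrix.specialUnitaryGroup (Fin 2) ℂ))) hA] with a ha hs
    rw [ha, hs, ← integral_const_mul]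
    have h1 : (fun b => (∏ e, ((ν e : ℝ) + 1)) * ((∏ e, (U ℝ (ν e)).eval (su2a0 (b e * (a e)⁻¹))) * φ b)) =
        fun b => ∑ i, A i a * (B i b * φ b) := by
      funext b
      rw [← mul_assoc, hK a b, Finset.sum_mul]
      refine Finset.sum_congr rfl fun i _ => ?_
      ring
    rw [h1, integral_finsetSum _ fun i _ => (hBi i).const_mul (A i a)]
    refine Finset.sum_congr rfl fun i _ => ?_
    rw [integral_const_mul, mul_comm]
  rw [hPφ]
  exact Submodule.sum_mem _ fun i _ => Submodule.smul_mem _ _ (Submodule.subset_span ⟨i, rfl⟩)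

/-- **`range P_ν` is FINITE-DIMENSIONAL** for any operator acting a.e. by the reproducing integral of link type `ν`.
[cite: MontvayMunster1994, §3.4.2] -/
theorem finiteDimensional_range_charProjOp (ν : ι → ℕ)
    {P : Lp ℝ 2 (Measure.pi fun _ : ι => haarProbability (Matrix.specialUnitaryGroup (Fin 2) ℂ)) →L[ℝ]
        Lp ℝ 2 (Measure.pi fun _ : ι => haarProbability (Matrix.specialUnitaryGroup (Fin 2) ℂ))}
    (hP : ∀ φ, (P φ : (ι → Matrix.specialUnitaryGroup (Fin 2) ℂ) → ℝ)
        =ᵐ[Measure.pi fun _ : ι => haarProbability (Matrix.specialUnitaryGroup (Fin 2) ℂ)]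
        fun a => (∏ e, ((ν e : ℝ) + 1)) * ∫ b, (∏ e, (U ℝ (ν e)).eval (su2a0 (b e * (a e)⁻¹))) * φ b
          ∂(Measure.pi fun _ : ι => haarProbability (Matrix.specialUnitaryGroup (Fin 2) ℂ))) :
    FiniteDimensional ℝ (LinearMap.range (P : Lp ℝ 2 (Measure.pi fun _ : ι =>
        haarProbability (Matrix.specialUnitaryGroup (Fin 2) ℂ)) →ₗ[ℝ]
      Lp ℝ 2 (Measure.pi fun _ : ι => haarProbability (Matrix.specialUnitaryGroup (Fin 2) ℂ)))) := by
  obtain ⟨κ, hκ, w, hw⟩ := charProjOp_mem_span_finite ν hP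
  haveI : FiniteDimensional ℝ (Submodule.span ℝ (Set.range w)) :=
    FiniteDimensional.span_of_finite ℝ (Set.finite_range w)
  refine Submodule.finiteDimensional_of_le (S₂ := Submodule.span ℝ (Set.range w)) ?_
  rintro _ ⟨φ, rfl⟩
  exact hw φ

end Range

end KWeightTailOperator

end Summit.Ventures.YMGap.FlowData
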